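import Literature.AnabelianGeometry.SemiGraphs.PSCSeparatingCoveringsCrossVertex
import HarnessLib

/-!
# [CombGC] Prop. 1.2, proof p. 9: the separating-coverings engines RUN INSIDE AN OPEN LEVEL (free factors of a level)

Mochizuki, *A combinatorial version of the Grothendieck conjecture*, Tohoku Math. J. **59** (2007)
[CombGC], PROOF of Proposition 1.2, author's manuscript p. 9 ("… possibly replacing `G` by some finite étale
covering of `G` … there exists a finite étale … covering `G' → G` whose restriction to the anabelioid
`G_{v₂}` [resp. `G_{e₂}`] is trivial …, but whose restriction to `G_{v₁}` [resp. `G_{e₁}`] is nontrivial")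
[cite: MochizukiCombGC2007, Prop 1.2 proof p.9].

abc-iut-f-166 gen 3's two engines (`freeFactor_exists_open_separating_sameVertex` — fibred twist —,
`freeFactor_exists_open_separating_crossVertex` — projection) separate conjugates `γ₂Aγ₂⁻¹`, `γ₁A'γ₁⁻¹`
inside an open normal level `V ⊴ Π` when `A = cl ι⟨b(S)⟩` is the closure of a FREE FACTOR of the dense
free group `Γ` (`ι : Γ → Π` a pro-`Σ` completion).  At the genuine carriers now in progress (the node of
an UNMARKED component, `cl ι⟨∏_{i≥g₀}[a_i,b_i]⟩`; the vertex group of an irreducible nodal curve — the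
HNN base) the relevant subgroup is NOT a free factor of `Γ`, but it IS a free factor of an OPEN NORMAL
LEVEL `N₀ = ι⁻¹(Π₀) ⊴ Γ` of `Σ`-integer index (abc-iut-w5-d174's Schreier basis of the cyclic kernel,
`FreeGroupCyclicKernelBasis.lean`; "replacing `G` by a finite étale covering" in print).  This PROOF-ONLY
file (abc-iut-f-166 gen 5, theorems only) runs both engines INSIDE `Π₀` — along the restriction
`ι| : N₀ → Π₀`, again a pro-`Σ` completion (`IsProSigmaCompletion.restrict`) — and pushes the separating
open subgroup back out to `Π`:

* `level_exists_open_separating_sameVertex` — `A = cl ι⟨b(S)⟩` for a free basis `b` of `N₀`, `V ⊴ Π` open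
  with `V ≤ Π₀`, conjugators `y₁, y₂ ∈ Π₀` with distinct double cosets `Vy₁A ≠ Vy₂A`: an open `U ≤ V`,
  normal in `V`, with `y₂Ay₂⁻¹ ∩ V ≤ U` and `y₁Ay₁⁻¹ ∩ V ⊄ U`;
* `level_exists_open_separating_crossVertex` — `A₂ = cl ι⟨b(S)⟩` killed by the retraction `ρ` of `N₀`
  onto the complementary letters, `A₁ ∋ ι(a)` with `ρ(a) ≠ 1`, `y₁, y₂ ∈ Π₀`: the same conclusion, for ALL
  `y₁, y₂`;
* `retract_apply_ne_one_of_hom` — the CERTIFICATE for `ρ(a) ≠ 1`: any homomorphism killing the letters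
  `b(S)` and not `a`.

Conjugators outside `Π₀` are reduced to these by the consumer (translate by coset representatives
`ι(t^m)`, which moves `A` to the closure of ANOTHER free factor of the level).  Plain (pro)finite group
theory over abc-iut-L3-t1's interface; nothing here takes a side on [IUTchIII] Cor. 3.12.
-/

noncomputable section

namespace Literature.AnabelianGeometry.SemiGraphs

open scoped Pointwise
open Topology

universe u

/-! ### Bookkeeping: subgroups of an open subgroup `Π₀ ≤ Π` pushed out to `Π` -/

section PushOut

variable {P : Type u} [Group P]

/-- For `V ≤ Π₀`: `(V ∩ Π₀ as a subgroup of Π₀)` pushed out is `V`. [cite: MochizukiCombGC2007, Prop 1.2 proof p.9] -/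
theorem map_subtype_subgroupOf_eq_of_le {P₀ V : Subgroup P} (hVP : V ≤ P₀) :
    (V.subgroupOf P₀).map P₀.subtype = V := by
  rw [Subgroup.subgroupOf_map_subtype, inf_eq_left.mpr hVP]

/-- For `V ≤ Π₀`, `y ∈ Π₀` and `J ≤ Π₀`: pushing out `(yJy⁻¹) ∩ V` computed in `Π₀` gives `(yJy⁻¹) ∩ V` in `Π`.
[cite: MochizukiCombGC2007, Prop 1.2 proof p.9] -/
theorem map_subtype_smul_inf_subgroupOf {P₀ V : Subgroup P} (hVP : V ≤ P₀) (J : Subgroup P₀) (y : P₀) :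
    ((ConjAct.toConjAct y • J) ⊓ V.subgroupOf P₀).map P₀.subtype =
      (ConjAct.toConjAct (y : P) • J.map P₀.subtype) ⊓ V := by
  rw [Subgroup.map_inf _ _ P₀.subtype Subtype.val_injective, map_subtype_subgroupOf_eq_of_le hVP]
  congr 1
  -- push the conjugate out (cf. `map_subtype_conjAct_smul` of `ProSigmaUnmarkedNodeMalnormal.lean`, stated
  -- there for `Π : Type`)
  ext z
  simp only [Subgroup.mem_map, Subgroup.mem_smul_pointwise_iff_exists, ConjAct.toConjAct_smul,
    Subgroup.coe_subtype]
  constructor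
  · rintro ⟨_, ⟨j, hj, rfl⟩, rfl⟩
    exact ⟨(j : P), ⟨j, hj, rfl⟩, by simp⟩
  · rintro ⟨_, ⟨j, hj, rfl⟩, rfl⟩
    exact ⟨y * j * y⁻¹, ⟨j, hj, rfl⟩, by simp⟩

/-- Normality in `V` passes from `U₀ ⊴ V ∩ Π₀` (inside `Π₀`) to the push-out `U ⊴ V` (`V ≤ Π₀`).
[cite: MochizukiCombGC2007, Prop 1.2 proof p.9] -/
theorem normal_subgroupOf_map_subtype {P₀ V : Subgroup P} (hVP : V ≤ P₀) (U₀ : Subgroup P₀)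
    (hn : (U₀.subgroupOf (V.subgroupOf P₀)).Normal) : ((U₀.map P₀.subtype).subgroupOf V).Normal := by
  refine ⟨fun u hu v => ?_⟩
  rw [Subgroup.mem_subgroupOf] at hu ⊢
  obtain ⟨u₀, hu₀, hu₀e⟩ := hu
  have hue : (u₀ : P) = (u : P) := hu₀e
  have hvP : (v : P) ∈ P₀ := hVP v.2
  have hv₀ : (⟨(v : P), hvP⟩ : P₀) ∈ V.subgroupOf P₀ := by
    rw [Subgroup.mem_subgroupOf]; exact v.2
  have hu₀V : u₀ ∈ V.subgroupOf P₀ := by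
    rw [Subgroup.mem_subgroupOf, hue]; exact u.2
  have h := hn.conj_mem ⟨u₀, hu₀V⟩ (by rw [Subgroup.mem_subgroupOf]; exact hu₀) ⟨⟨(v : P), hvP⟩, hv₀⟩
  rw [Subgroup.mem_subgroupOf] at h
  refine ⟨⟨(v : P), hvP⟩ * u₀ * ⟨(v : P), hvP⟩⁻¹, by simpa using h, ?_⟩
  simp only [Subgroup.coe_subtype, Subgroup.coe_mul, InvMemClass.coe_inv, hue]

end PushOut

namespace SemiGraphOfAnabelioids.IsProSigmaCompletion

open Literature.AnabelianGeometry.Anabelioids (IsSigmaInteger)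

variable {Sigma : Set ℕ} {Γ : Type u} [Group Γ] {P : Type u} [Group P] [TopologicalSpace P]
  [IsTopologicalGroup P] [CompactSpace P] [TotallyDisconnectedSpace P] {ι : Γ →* P}

/-! ### The certificate for `ρ(a) ≠ 1` -/

omit [TopologicalSpace P] [IsTopologicalGroup P] [CompactSpace P] [TotallyDisconnectedSpace P] in
/-- **Certificate.**  If `ρ` is the retraction of the free group `Γ` (basis `b`) killing the letters of `S`
and some homomorphism `ψ` kills those letters but not `a`, then `ρ(a) ≠ 1` (`ψ ∘ ρ = ψ`).
[cite: LyndonSchupp2001, I.3 Prop 3.8] -/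
theorem retract_apply_ne_one_of_hom {β : Type*} (b : FreeGroupBasis β Γ) (S : Set β)
    [DecidablePred (· ∈ S)] (ρ : Γ →* Γ) (hρ : ∀ j, ρ (b j) = if j ∈ S then 1 else b j)
    {M : Type*} [Group M] (ψ : Γ →* M) (hψ : ∀ j ∈ S, ψ (b j) = 1) {a : Γ} (ha : ψ a ≠ 1) : ρ a ≠ 1 := by
  have hcomp : ψ.comp ρ = ψ := by
    refine b.ext_hom _ _ fun j => ?_
    rw [MonoidHom.comp_apply, hρ j]
    by_cases hj : j ∈ S
    · rw [if_pos hj, map_one, hψ j hj]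
    · rw [if_neg hj]
  intro h
  apply ha
  rw [← hcomp, MonoidHom.comp_apply, h, map_one]

/-! ### Bookkeeping along `ι| : ι⁻¹(Π₀) → Π₀` -/

omit [CompactSpace P] [TotallyDisconnectedSpace P] in
/-- The closure in `Π` of `ι` of a subgroup `X ≤ ι⁻¹(Π₀)` is the push-out of its closure in `Π₀` along
`ι|` (`Π₀` open, hence closed). [cite: MochizukiCombGC2007, Prop 1.2 proof p.9] -/
theorem topologicalClosure_map_map_subtype_eq (P₀ : Subgroup P) (hP₀ : IsOpen (P₀ : Set P))
    (X : Subgroup (P₀.comap ι)) :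
    ((X.map (P₀.comap ι).subtype).map ι).topologicalClosure =
      ((X.map (ι.subgroupComap P₀)).topologicalClosure).map P₀.subtype := by
  have hcomp : ι.comp (P₀.comap ι).subtype = P₀.subtype.comp (ι.subgroupComap P₀) := by
    ext x; rfl
  rw [Subgroup.map_map, hcomp, ← Subgroup.map_map]
  exact topologicalClosure_map_of_isClosedEmbedding P₀.subtype
    ((P₀.isClosed_of_isOpen hP₀).isClosedEmbedding_subtypeVal) _

omit [TopologicalSpace P] [IsTopologicalGroup P] [CompactSpace P] [TotallyDisconnectedSpace P] in
/-- Double cosets inside `Π₀` push out to double cosets in `Π`. [cite: MochizukiCombGC2007, Prop 1.2 proof p.9] -/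
theorem image_val_doubleCoset (P₀ : Subgroup P) (y : P₀) (V₀ A₀ : Subgroup P₀) :
    Subtype.val '' DoubleCoset.doubleCoset y (V₀ : Set P₀) (A₀ : Set P₀) =
      DoubleCoset.doubleCoset (y : P) ((V₀.map P₀.subtype : Subgroup P) : Set P)
        ((A₀.map P₀.subtype : Subgroup P) : Set P) := by
  ext z
  simp only [Set.mem_image, DoubleCoset.mem_doubleCoset, SetLike.mem_coe, Subgroup.mem_map,
    Subgroup.coe_subtype]
  constructor
  · rintro ⟨_, ⟨v, hv, a, ha, rfl⟩, rfl⟩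
    exact ⟨v, ⟨v, hv, rfl⟩, a, ⟨a, ha, rfl⟩, by simp⟩
  · rintro ⟨_, ⟨v, hv, rfl⟩, _, ⟨a, ha, rfl⟩, rfl⟩
    exact ⟨v * y * a, ⟨v, hv, a, ha, rfl⟩, by simp⟩

/-! ### The fibred twist inside a level -/

/-- **[CombGC] Prop. 1.2, proof p. 9 — separating two level copies of ONE subgroup that is a free factor
OF AN OPEN LEVEL.**  `ι : Γ → Π` a profinite pro-`Σ` completion; `Π₀ ⊴ Π` open; `b` a free basis of the
level `N₀ = ι⁻¹(Π₀)`, `S ≠ ∅`, `A = cl ι⟨b(S)⟩`; `ℓ ∈ Σ` prime; `V ⊴ Π` open with `V ≤ Π₀`; `y₁, y₂ ∈ Π₀` with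
`Vy₁A ≠ Vy₂A`.  Then there is an open `U ≤ V`, normal in `V`, with `y₂Ay₂⁻¹ ∩ V ≤ U` and `y₁Ay₁⁻¹ ∩ V ⊄ U`
(abc-iut-f-166 gen 3's `freeFactor_exists_open_separating_sameVertex` along `ι| : N₀ → Π₀`, pushed out).
[cite: MochizukiCombGC2007, Prop 1.2 proof p.9] -/
theorem level_exists_open_separating_sameVertex (hι : IsProSigmaCompletion Sigma ι)
    (P₀ : Subgroup P) [P₀.Normal] (hP₀ : IsOpen (P₀ : Set P))
    {β : Type*} (b : FreeGroupBasis β (P₀.comap ι)) (S : Set β) (hS : S.Nonempty)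
    {ℓ : ℕ} (hℓ : ℓ.Prime) (hℓS : ℓ ∈ Sigma) (A : Subgroup P)
    (hA : A = (((Subgroup.closure (b '' S)).map (P₀.comap ι).subtype).map ι).topologicalClosure)
    (V : Subgroup P) [hVn : V.Normal] (hVo : IsOpen (V : Set P)) (hVP : V ≤ P₀)
    {y₁ y₂ : P} (hy₁ : y₁ ∈ P₀) (hy₂ : y₂ ∈ P₀)
    (hne : DoubleCoset.doubleCoset y₁ (V : Set P) (A : Set P) ≠
      DoubleCoset.doubleCoset y₂ (V : Set P) (A : Set P)) :
    ∃ U : Subgroup P, IsOpen (U : Set P) ∧ U ≤ V ∧ (U.subgroupOf V).Normal ∧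
      (ConjAct.toConjAct y₂ • A) ⊓ V ≤ U ∧ ¬ ((ConjAct.toConjAct y₁ • A) ⊓ V ≤ U) := by
  classical
  haveI : CompactSpace P₀ := isCompact_iff_compactSpace.mp (P₀.isClosed_of_isOpen hP₀).isCompact
  have hι₀ : IsProSigmaCompletion Sigma (ι.subgroupComap P₀) := restrict hι P₀ hP₀
  set A₀ : Subgroup P₀ := ((Subgroup.closure (b '' S)).map (ι.subgroupComap P₀)).topologicalClosure
    with hA₀
  have hAA₀ : A = A₀.map P₀.subtype := by
    rw [hA, topologicalClosure_map_map_subtype_eq P₀ hP₀]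
  set V₀ : Subgroup P₀ := V.subgroupOf P₀ with hV₀
  haveI : V₀.Normal := by rw [hV₀]; infer_instance
  have hV₀o : IsOpen (V₀ : Set P₀) := hVo.preimage continuous_subtype_val
  have hVV₀ : V = V₀.map P₀.subtype := (map_subtype_subgroupOf_eq_of_le hVP).symm
  -- distinct double cosets inside `Π₀`
  have hne₀ : DoubleCoset.doubleCoset (ConjAct.ofConjAct (ConjAct.toConjAct (⟨y₁, hy₁⟩ : P₀)))
      (V₀ : Set P₀) (A₀ : Set P₀) ≠
      DoubleCoset.doubleCoset (ConjAct.ofConjAct (ConjAct.toConjAct (⟨y₂, hy₂⟩ : P₀)))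
      (V₀ : Set P₀) (A₀ : Set P₀) := by
    intro h
    apply hne
    have h' := congrArg (Set.image (Subtype.val : P₀ → P)) h
    rwa [ConjAct.ofConjAct_toConjAct, ConjAct.ofConjAct_toConjAct, image_val_doubleCoset,
      image_val_doubleCoset, ← hVV₀, ← hAA₀] at h'
  obtain ⟨U₀, hU₀o, hU₀V, hU₀n, h₂, h₁⟩ := freeFactor_exists_open_separating_sameVertex hι₀ b S hS hℓ
    hℓS A₀ hA₀ V₀ hV₀o (ConjAct.toConjAct (⟨y₁, hy₁⟩ : P₀)) (ConjAct.toConjAct (⟨y₂, hy₂⟩ : P₀)) hne₀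
  refine ⟨U₀.map P₀.subtype, isOpen_map_subtype P₀ hP₀ U₀ hU₀o, ?_,
    normal_subgroupOf_map_subtype hVP U₀ hU₀n, ?_, fun hle => h₁ ?_⟩
  · rw [hVV₀]; exact Subgroup.map_mono hU₀V
  · have h := Subgroup.map_mono (f := P₀.subtype) h₂
    rwa [map_subtype_smul_inf_subgroupOf hVP, ← hAA₀] at h
  · intro z hz
    have hz' : (z : P) ∈ (ConjAct.toConjAct y₁ • A) ⊓ V := by
      have : (z : P) ∈ ((ConjAct.toConjAct (⟨y₁, hy₁⟩ : P₀) • A₀) ⊓ V₀).map P₀.subtype := ⟨z, hz, rfl⟩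
      rwa [map_subtype_smul_inf_subgroupOf hVP, ← hAA₀] at this
    obtain ⟨u, hu, hue⟩ := hle hz'
    rwa [← Subtype.val_injective hue]

/-! ### The projection inside a level -/

/-- **[CombGC] Prop. 1.2, proof p. 9 — separating a level copy of `A₁` from a level copy of `A₂` when
`A₂` is killed by a retraction OF AN OPEN LEVEL under which an element of `A₁` survives.**  `ι : Γ → Π`
a profinite pro-`Σ` completion (`Σ ∋` a prime); `Π₀ ⊴ Π` open; `b` a free basis of `N₀ = ι⁻¹(Π₀)`;
`A₂ = cl ι⟨b(S)⟩`; `ρ : N₀ → N₀` the projection killing the letters of `S`; `A₁ ≤ Π` containing `ι(a)`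
for some `a ∈ N₀` with `ρ(a) ≠ 1`; `V ⊴ Π` open with `V ≤ Π₀`.  Then for ALL `y₁, y₂ ∈ Π₀` there is an open
`U ≤ V`, normal in `V`, with `y₂A₂y₂⁻¹ ∩ V ≤ U` and `y₁A₁y₁⁻¹ ∩ V ⊄ U` (abc-iut-f-166 gen 3's
`freeFactor_exists_open_separating_crossVertex` along `ι| : N₀ → Π₀`, pushed out).
[cite: MochizukiCombGC2007, Prop 1.2 proof p.9] -/
theorem level_exists_open_separating_crossVertex (hι : IsProSigmaCompletion Sigma ι)
    (hSig : ∃ ℓ ∈ Sigma, ℓ.Prime) (P₀ : Subgroup P) [P₀.Normal] (hP₀ : IsOpen (P₀ : Set P))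
    {β : Type*} (b : FreeGroupBasis β (P₀.comap ι)) (S : Set β) [DecidablePred (· ∈ S)]
    (ρ : (P₀.comap ι) →* (P₀.comap ι)) (hρ : ∀ j, ρ (b j) = if j ∈ S then 1 else b j)
    (A₂ : Subgroup P)
    (hA₂ : A₂ = (((Subgroup.closure (b '' S)).map (P₀.comap ι).subtype).map ι).topologicalClosure)
    (A₁ : Subgroup P) (a : P₀.comap ι) (haA : ι (a : Γ) ∈ A₁) (hρa : ρ a ≠ 1)
    (V : Subgroup P) [hVn : V.Normal] (hVo : IsOpen (V : Set P)) (hVP : V ≤ P₀)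
    {y₁ y₂ : P} (hy₁ : y₁ ∈ P₀) (hy₂ : y₂ ∈ P₀) :
    ∃ U : Subgroup P, IsOpen (U : Set P) ∧ U ≤ V ∧ (U.subgroupOf V).Normal ∧
      (ConjAct.toConjAct y₂ • A₂) ⊓ V ≤ U ∧ ¬ ((ConjAct.toConjAct y₁ • A₁) ⊓ V ≤ U) := by
  classical
  haveI : CompactSpace P₀ := isCompact_iff_compactSpace.mp (P₀.isClosed_of_isOpen hP₀).isCompact
  have hι₀ : IsProSigmaCompletion Sigma (ι.subgroupComap P₀) := restrict hι P₀ hP₀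
  set A₂₀ : Subgroup P₀ := ((Subgroup.closure (b '' S)).map (ι.subgroupComap P₀)).topologicalClosure
    with hA₂₀
  have hAA₀ : A₂ = A₂₀.map P₀.subtype := by
    rw [hA₂, topologicalClosure_map_map_subtype_eq P₀ hP₀]
  set A₁₀ : Subgroup P₀ := A₁.subgroupOf P₀ with hA₁₀
  have haA₀ : ι.subgroupComap P₀ a ∈ A₁₀ := by
    rw [hA₁₀, Subgroup.mem_subgroupOf]; exact haA
  set V₀ : Subgroup P₀ := V.subgroupOf P₀ with hV₀
  haveI : V₀.Normal := by rw [hV₀]; infer_instance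
  have hV₀o : IsOpen (V₀ : Set P₀) := hVo.preimage continuous_subtype_val
  have hVV₀ : V = V₀.map P₀.subtype := (map_subtype_subgroupOf_eq_of_le hVP).symm
  obtain ⟨U₀, hU₀o, hU₀V, hU₀n, h₂, h₁⟩ := freeFactor_exists_open_separating_crossVertex hι₀ hSig b S ρ
    hρ A₂₀ hA₂₀ A₁₀ a haA₀ hρa V₀ hV₀o (ConjAct.toConjAct (⟨y₁, hy₁⟩ : P₀))
    (ConjAct.toConjAct (⟨y₂, hy₂⟩ : P₀))
  refine ⟨U₀.map P₀.subtype, isOpen_map_subtype P₀ hP₀ U₀ hU₀o, ?_,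
    normal_subgroupOf_map_subtype hVP U₀ hU₀n, ?_, fun hle => h₁ ?_⟩
  · rw [hVV₀]; exact Subgroup.map_mono hU₀V
  · have h := Subgroup.map_mono (f := P₀.subtype) h₂
    rwa [map_subtype_smul_inf_subgroupOf hVP, ← hAA₀] at h
  · intro z hz
    have hz' : (z : P) ∈ (ConjAct.toConjAct y₁ • A₁) ⊓ V := by
      have hmem : (z : P) ∈ ((ConjAct.toConjAct (⟨y₁, hy₁⟩ : P₀) • A₁₀) ⊓ V₀).map P₀.subtype :=
        ⟨z, hz, rfl⟩
      rw [map_subtype_smul_inf_subgroupOf hVP] at hmem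
      refine ⟨?_, hmem.2⟩
      obtain ⟨x, hx, hxe⟩ := (Subgroup.mem_smul_pointwise_iff_exists _ _ _).mp hmem.1
      obtain ⟨x₀, hx₀, rfl⟩ := hx
      have hx₀' : (x₀ : P) ∈ A₁ := Subgroup.mem_subgroupOf.mp hx₀
      rw [← hxe]
      exact Subgroup.smul_mem_pointwise_smul _ _ _ hx₀' 
    obtain ⟨u, hu, hue⟩ := hle hz'
    rwa [← Subtype.val_injective hue]

end SemiGraphOfAnabelioids.IsProSigmaCompletion

end Literature.AnabelianGeometry.SemiGraphs

end
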